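import Mathlib
import Literature.NumberTheory.LFunctions.WeilFiniteCodimension
import Literature.NumberTheory.LFunctions.WeilFourierGridWindow

/-!
# Coercivity of the Weil form from a window majorant — Yoshida's Lemma 3 with explicit constants

Literature/NumberTheory/LFunctions.  H. Yoshida, *On Hermitian forms attached to zeta functions*,
Adv. Stud. Pure Math. **21** (1992) 281–325, §3 Lemma 3 (p. 290) and its quantitative form §6
(6.3)–(6.7) (pp. 303–305): on the window `[-a, a]`, once the transform `ĝ(1/2+it)` is known to be small
for `|t| ≤ T` (Yoshida: because the low Fourier coefficients of `g` vanish, cf. the Fourier-grid window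
estimate `norm_sq_weilMellin_le_of_fourierGrid_zero_sinc` of `WeilFourierGridWindow.lean`), the Weil form is
bounded below by an EXPLICIT multiple of `‖g‖₂²`, the archimedean weight `Re ψ(1/4 + it/2)` being `≥ L`
beyond `|t| ≥ T`.

`weilQuadratic_re_ge_of_window_majorant`: for a test function `g` with `tsupport g ⊆ [-a, a]`, a level `L`
with `Re ψ(1/4) ≤ L ≤ Re ψ(1/4 + it/2)` for `|t| ≥ T`, and a continuous majorant `D` on `[-T, T]` with
`|ĝ(1/2+it)|² ≤ D(t) ‖g‖₂²` there,

  `(L − K(a) − (L − Re ψ(1/4))/(2π) · ∫_{-T}^{T} D) · ‖g‖₂² ≤ Re Q(g)`,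

`K(a) = 2(sinh a − a) + 2 Σ_{n ≤ e^{2a}} Λ(n)/√n + log π` (the tree's bound of the polar and prime terms,
`weilArchIntegral_le_weilQuadratic_re`).  This is the tree's qualitative `weilQuadratic_re_ge_of_grid_zero`
(`WeilFiniteCodimension.lean`, same proof skeleton) with the constants kept: the statement a Fourier–Galerkin
certificate of `WeilPositivityOn a` needs for the complement block ("μ_N", Yoshida (6.7)), the choice of the
vanishing conditions and of `D` being left to the user.  RH-free; no definitions, no named facts.
-/

noncomputable section

open Complex Filter Set MeasureTheory
open scoped Real Topology ComplexConjugate ArithmeticFunction.vonMangoldt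

namespace Literature.NumberTheory.LFunctions

open Literature.Analysis.SpecialFunctions

variable {g : ℝ → ℂ}

/-- **Yoshida's Lemma 3 with explicit constants** (complement coercivity from a window majorant).  Let
`tsupport g ⊆ [-a, a]`, `0 < T`, `Re ψ(1/4) ≤ L ≤ Re ψ(1/4 + it/2)` for all `|t| ≥ T`, and let `D` be
continuous on `[-T, T]` with `|ĝ(1/2+it)|² ≤ D(t)·‖g‖₂²` there.  Then
`(L − K(a) − (L − Re ψ(1/4))/(2π) ∫_{-T}^{T} D) ‖g‖₂² ≤ Re Q(g)` with
`K(a) = 2(sinh a − a) + 2 Σ_{n ≤ e^{2a}} Λ(n)/√n + log π`.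
[cite: Yoshida1992HermitianForms, §3 Lemma 3 (p. 290) and §6 (6.3)–(6.7)] -/
theorem weilQuadratic_re_ge_of_window_majorant (hg : IsWeilTest g) {a : ℝ}
    (hsupp : tsupport g ⊆ Icc (-a) a) {T L : ℝ} (hT : 0 < T) (hL0 : reDigammaQuarter 0 ≤ L)
    (hLT : ∀ t : ℝ, T ≤ |t| → L ≤ reDigammaQuarter t) {D : ℝ → ℝ} (hDc : ContinuousOn D (Icc (-T) T))
    (hD : ∀ t ∈ Icc (-T) T, ‖weilMellin g (1 / 2 + t * I)‖ ^ 2 ≤ D t * weilNorm2Sq g) :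
    (L - (2 * (Real.sinh a - a)
          + 2 * (∑ n ∈ Finset.range (⌊Real.exp (2 * a)⌋₊ + 1), (Λ n : ℝ) / Real.sqrt n)
          + Real.log π)
        - (L - reDigammaQuarter 0) / (2 * π) * ∫ t in (-T)..T, D t) * weilNorm2Sq g
      ≤ (weilQuadratic g).re := by
  -- constants
  set ρ₀ : ℝ := reDigammaQuarter 0 with hρ₀
  set K : ℝ := 2 * (Real.sinh a - a)
    + 2 * (∑ n ∈ Finset.range (⌊Real.exp (2 * a)⌋₊ + 1), (Λ n : ℝ) / Real.sqrt n)
    + Real.log π with hK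
  set ℓ : ℝ := L - ρ₀ with hℓ
  have hℓnn : 0 ≤ ℓ := by rw [hℓ]; linarith
  set W : ℝ := ∫ t in (-T)..T, D t with hW
  -- abbreviations
  set n2 : ℝ := weilNorm2Sq g with hn2
  have hn2nn : 0 ≤ n2 := weilNorm2Sq_nonneg g
  set H : ℝ → ℂ := fun t ↦ weilMellin g (1 / 2 + t * I) with hH
  set A : ℝ := ∫ t : ℝ, ‖H t‖ ^ 2 * reDigammaQuarter t with hA
  set q : ℝ := (weilQuadratic g).re with hq
  -- (1) bounded polar and prime terms
  have harch : A ≤ 2 * π * q + 2 * π * K * n2 := by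
    have h := weilArchIntegral_le_weilQuadratic_re hg hsupp
    have hπ2 : 0 < 2 * π := by positivity
    rw [div_mul_eq_mul_div, one_mul, div_le_iff₀ hπ2] at h
    change A ≤ (q + K * n2) * (2 * π) at h
    linarith
  -- (2) `D ≥ 0` is not needed; the window bound enters through the pointwise inequality
  -- pointwise: `ℓ |H|² ≤ 1_{[-T,T]} ℓ D n2 + |H|² (ρ − ρ₀)`
  have hpt : ∀ t : ℝ, ℓ * ‖H t‖ ^ 2 ≤
      (Icc (-T) T).indicator (fun t ↦ ℓ * (D t * n2)) t + ‖H t‖ ^ 2 * (reDigammaQuarter t - ρ₀) := by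
    intro t
    have hρ : ρ₀ ≤ reDigammaQuarter t := reDigammaQuarter_zero_le t
    have hnn : 0 ≤ ‖H t‖ ^ 2 * (reDigammaQuarter t - ρ₀) :=
      mul_nonneg (sq_nonneg _) (sub_nonneg.2 hρ)
    by_cases ht : t ∈ Icc (-T) T
    · rw [indicator_of_mem ht]
      have h1 : ℓ * ‖H t‖ ^ 2 ≤ ℓ * (D t * n2) := mul_le_mul_of_nonneg_left (hD t ht) hℓnn
      linarith
    · rw [indicator_of_notMem ht, zero_add]
      have hTt : T ≤ |t| := by
        simp only [mem_Icc, not_and_or, not_le] at ht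
        rcases ht with h | h
        · rw [abs_of_neg (by linarith)]; linarith
        · exact h.le.trans (le_abs_self t)
      have hLt : L ≤ reDigammaQuarter t := hLT t hTt
      have hw : ℓ ≤ reDigammaQuarter t - ρ₀ := by rw [hℓ]; linarith
      exact mul_comm ℓ (‖H t‖ ^ 2) ▸ mul_le_mul_of_nonneg_left hw (sq_nonneg _)
  -- integrability
  have hint_H : Integrable fun t : ℝ ↦ ‖H t‖ ^ 2 := integrable_norm_sq_weilMellin_half_line hg
  have hint_lhs : Integrable fun t : ℝ ↦ ℓ * ‖H t‖ ^ 2 := hint_H.const_mul ℓ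
  have hDc' : ContinuousOn (fun t ↦ ℓ * (D t * n2)) (Icc (-T) T) :=
    continuousOn_const.mul (hDc.mul continuousOn_const)
  have hint_ind : Integrable ((Icc (-T) T).indicator fun t : ℝ ↦ ℓ * (D t * n2)) :=
    (hDc'.integrableOn_compact isCompact_Icc).integrable_indicator measurableSet_Icc
  have hint_w : Integrable fun t : ℝ ↦ ‖H t‖ ^ 2 * (reDigammaQuarter t - ρ₀) := by
    have h := (integrable_norm_sq_weilMellin_mul_reDigammaQuarter hg).sub (hint_H.mul_const ρ₀)
    refine h.congr (Eventually.of_forall fun t ↦ ?_)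
    simp only [Pi.sub_apply, hH]
    ring
  have hint_rhs : Integrable fun t : ℝ ↦
      (Icc (-T) T).indicator (fun t ↦ ℓ * (D t * n2)) t + ‖H t‖ ^ 2 * (reDigammaQuarter t - ρ₀) :=
    hint_ind.add hint_w
  have hmono := integral_mono hint_lhs hint_rhs hpt
  rw [integral_add hint_ind hint_w, integral_const_mul] at hmono
  -- evaluate the pieces
  have hP : ∫ t : ℝ, ‖H t‖ ^ 2 = 2 * π * n2 := by
    simp only [hH]
    rw [integral_norm_sq_weilMellin_half_line hg, hn2, weilNorm2Sq]
  have hI : ∫ t : ℝ, (Icc (-T) T).indicator (fun t : ℝ ↦ ℓ * (D t * n2)) t = ℓ * n2 * W := by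
    rw [integral_indicator measurableSet_Icc]
    have e : (fun t : ℝ ↦ ℓ * (D t * n2)) = fun t ↦ (ℓ * n2) * D t := by funext t; ring
    rw [e, integral_const_mul, hW, intervalIntegral.integral_of_le (by linarith),
      integral_Icc_eq_integral_Ioc]
  have hWval : ∫ t : ℝ, ‖H t‖ ^ 2 * (reDigammaQuarter t - ρ₀) = A - 2 * π * ρ₀ * n2 := by
    simp_rw [mul_sub]
    rw [integral_sub (by simpa [hH] using integrable_norm_sq_weilMellin_mul_reDigammaQuarter hg)
      (hint_H.mul_const ρ₀), integral_mul_const, hP, hA]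
    ring
  rw [hP, hI, hWval] at hmono
  -- hmono : ℓ (2π n2) ≤ ℓ n2 W + (A − 2π ρ₀ n2);  harch : A ≤ 2π q + 2π K n2
  have hπ : 0 < π := Real.pi_pos
  have key : 2 * π * ((L - K - ℓ / (2 * π) * W) * n2) ≤ 2 * π * q := by
    have e : 2 * π * ((L - K - ℓ / (2 * π) * W) * n2)
        = ℓ * (2 * π * n2) + 2 * π * ρ₀ * n2 - 2 * π * K * n2 - ℓ * n2 * W := by
      rw [hℓ]; field_simp; ring
    rw [e]
    linarith
  have := le_of_mul_le_mul_left key (by positivity : (0 : ℝ) < 2 * π)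
  simpa [hK, hℓ, hρ₀, hW, hn2, hq] using this

/-- **Corollary (Fourier grid, with Yoshida's sinc majorant).**  With the vanishing conditions
`ĝ(1/2 + iπn/a) = 0` (`n ∈ S`) the majorant may be taken from
`norm_sq_weilMellin_le_of_fourierGrid_zero` for ANY family of trial coefficients `λ_n(t)` continuous in `t`;
here the constant family `λ = 0` off the user's choice is not imposed — we state the version where the user
supplies `D` together with a proof that it dominates the grid distance, the typical `D` being a polynomial
upper bound of `2a − (1/2a) Σ_{n∈S} (2 sin((t−πn/a)a)/(t−πn/a))²` on `[-T, T]` with exactly computable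
integral.  [cite: Yoshida1992HermitianForms, §6 (6.3)–(6.7)] -/
theorem weilQuadratic_re_ge_of_fourierGrid_zero (hg : IsWeilTest g) {a : ℝ} (ha : 0 < a)
    (hsupp : tsupport g ⊆ Icc (-a) a) (S : Finset ℤ)
    (hzero : ∀ n ∈ S, weilMellin g (1 / 2 + ((π * n / a : ℝ) : ℂ) * I) = 0)
    {T L : ℝ} (hT : 0 < T) (hL0 : reDigammaQuarter 0 ≤ L)
    (hLT : ∀ t : ℝ, T ≤ |t| → L ≤ reDigammaQuarter t) {D : ℝ → ℝ} (hDc : ContinuousOn D (Icc (-T) T))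
    (hD : ∀ t ∈ Icc (-T) T, 2 * a - 1 / (2 * a) * ∑ n ∈ S,
        (if t = π * n / a then 2 * a else 2 * Real.sin ((t - π * n / a) * a) / (t - π * n / a)) ^ 2 ≤ D t) :
    (L - (2 * (Real.sinh a - a)
          + 2 * (∑ n ∈ Finset.range (⌊Real.exp (2 * a)⌋₊ + 1), (Λ n : ℝ) / Real.sqrt n)
          + Real.log π)
        - (L - reDigammaQuarter 0) / (2 * π) * ∫ t in (-T)..T, D t) * weilNorm2Sq g
      ≤ (weilQuadratic g).re := by
  refine weilQuadratic_re_ge_of_window_majorant hg hsupp hT hL0 hLT hDc fun t ht ↦ ?_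
  have h := norm_sq_weilMellin_le_of_fourierGrid_zero_sinc hg ha hsupp S hzero t
  calc ‖weilMellin g (1 / 2 + t * I)‖ ^ 2
      ≤ weilNorm2Sq g * (2 * a - 1 / (2 * a) * ∑ n ∈ S,
          (if t = π * n / a then 2 * a else 2 * Real.sin ((t - π * n / a) * a) / (t - π * n / a)) ^ 2) := h
    _ ≤ weilNorm2Sq g * D t := mul_le_mul_of_nonneg_left (hD t ht) (weilNorm2Sq_nonneg g)
    _ = D t * weilNorm2Sq g := mul_comm _ _

end Literature.NumberTheory.LFunctions
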